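import Mathlib
import Literature.Analysis.FluidPDE.IsometryInvariance
import Literature.Analysis.FluidPDE.CurlIsometryCovariance
import Literature.Analysis.FluidPDE.HelicityDensityPseudoscalar
import HarnessLib

/-!
# Crux `EulerZoomLiouville.PowerGaugeEulerLiouville` (stmt-NavierStokesRegularity-19832):
# O(3)-covariance of the CLASSICAL solution predicates and frame invariance of the classical tube strata

Route №10 `EulerZoomLiouville` (NavierStokesRegularity), crux E, LEAD key W2-COV (2026-08-29).  Companion of
`…ClassIsometry` / `…ClassIsometryTransport` (the WEAK class: suitable weak solutions, weak gradients, gauges are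
covariant under `u ↦ (τ, x) ↦ R u(τ, R⁻¹ x)`, `p ↦ (τ, x) ↦ p(τ, R⁻¹ x)` for a linear isometry `R` of `ℝ³`).

For the CLASSICAL predicate the forward covariance is ALREADY a Literature theorem:
`Literature.Analysis.FluidPDE.IsClassicalNSSolutionOn.conj_linearIsometryEquiv` (`IsometryInvariance.lean`; every operator of
the pointwise momentum equation — `timeDerivWithin`, `convect`, `Δ`, `gradient`, `div` — is transported there by name, on any
time set of unique differentiability).  This file adds only what the skeleton consumes BY NAME:

* §1 `isClassicalNSSolutionOn_of_conj` / `_conj_iff` (the converse, by conjugating back with `R⁻¹`), and the zero-force Euler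
  twins `isClassicalEulerSolutionOn_conj` / `_of_conj` / `_conj_iff` / `_Iio_conj_iff` (the force `(τ,x) ↦ R 0 = 0` is
  discharged by `congr_force`; `Set.Iio T` has unique differentiability);
* §2 slice bricks: velocity envelopes and slab bounds are invariant (`‖R v‖ = ‖v‖`), a COHERENT VORTEX-TUBE DATUM `χ` of a slice
  `v` becomes the datum `χ ∘ R⁻¹` of the conjugated slice (`tubeWeight_conj_iff`; the vorticity is a pseudo-vector,
  `curl_conj_linearIsometryEquiv`: `curl (R v R⁻¹) = det R • R (curl v) ∘ R⁻¹`), and the WEIGHTED HELICITY is a pseudo-scalar,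
  `∫ (χ∘R⁻¹) ⟪R v R⁻¹, curl (R v R⁻¹)⟫ = det R · ∫ χ ⟪v, curl v⟫` (`weightedHelicity_conj`, from
  `inner_self_curl_conj_linearIsometryEquiv` and the measure-preserving change of variables), so `≠ 0` is invariant
  (`det R = ±1`): BOTH chiralities are one stratum;
* §3 the two fixed-frame CLASSICAL strata of the LEAD's skeleton v115 that are frame-free in truth — `IsChiralTubePast u p` and
  `IsHelicalTubePast ρ u p` (`Cruxes/PowerGaugeEulerLiouville/Lines/birth.lean`, δ-unfolded here binder for binder, since a Theorems
  file cannot import the Cruxes workfile) — are INVARIANT at the definition level: `chiralTubePast_conj` / `_of_conj`,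
  `helicalTubePast_conj` / `_of_conj` (the `iff` is `⟨_of_conj R, _conj R⟩`), and the collapse of the `∃ R`-widened binders to the registered ones,
  `exists_chiralTubePast_conj_iff`, `exists_helicalTubePast_conj_iff`.

Consequently the skeleton may keep the v114 binders `¬ IsChiralTubePast u p`, `¬ IsHelicalTubePast ρ u p` (they already deny every
frame), or fill the `∃ R` forms with ONE name (`…_of_conj`).  The AXIS-dependent strata (`IsSlabBoundedSwirlFree`, `IsMirrorOutgoing ρ`,
`IsAxisymSlowDrifting ρ`: axisymmetry about `e₃`, mirror plane `{x₃ = 0}`) are NOT frame-invariant as typed — only their classical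
and envelope clauses are (§1–§2); their any-axis members are `…WeakAxisymAnyAxis` / `…AxisymSlowDriftingAnyAxis` / the casimir any-axis member.

WHAT THIS IS NOT: not NS, not E, no stub of 19832 is closed — definition-level frame bookkeeping for the hypothetical Euler
zoom-limit class; the crux stays OPEN; no summit statement is proved here.
[cite: MajdaBertozziCUP2002, §1.2 Prop. 1.1 (ii)–(iii); ArfkenWeber1995, §2.9 eq. (2.90)]
-/

noncomputable section

-- flat `Theorems/<Route><Decl>…` files of one crux share the namespace of the crux (tree convention)
set_option linter.dupNamespace false

open MeasureTheory Set Filter Topology Metric Function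
open scoped NNReal ENNReal RealInnerProductSpace ContDiff

namespace Summit.NavierStokesRegularity.NavierStokesRegularity.Theorems.PowerGaugeEulerLiouville.ClassIsometry

open Literature.Analysis Literature.Analysis.FluidPDE

/-! ### §1 Classical Navier–Stokes / Euler predicates: the converse direction and the zero-force Euler twins -/

section Classical

variable {E : Type*} [NormedAddCommGroup E] [InnerProductSpace ℝ E] [FiniteDimensional ℝ E]
variable (R : E ≃ₗᵢ[ℝ] E) {S : Set ℝ} {ν : ℝ} {f u : ℝ → E → E} {p : ℝ → E → ℝ}

/-- **Converse covariance of the classical Navier–Stokes predicate.**  If the conjugated triple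
`(τ,x) ↦ R f(τ, R⁻¹x)`, `(τ,x) ↦ R u(τ, R⁻¹x)`, `(τ,x) ↦ p(τ, R⁻¹x)` is a classical solution on a time set of unique
differentiability, so is `(f, u, p)`: conjugate back with `R⁻¹` (the tree's `IsClassicalNSSolutionOn.conj_linearIsometryEquiv`)
and use `R⁻¹ (R v) = v`. [cite: MajdaBertozziCUP2002, §1.2 Prop. 1.1 (iii)] -/
theorem isClassicalNSSolutionOn_of_conj (hS : UniqueDiffOn ℝ S)
    (h : IsClassicalNSSolutionOn S ν (fun τ x => R (f τ (R.symm x))) (fun τ x => R (u τ (R.symm x)))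
      (fun τ x => p τ (R.symm x))) :
    IsClassicalNSSolutionOn S ν f u p := by
  simpa only [LinearIsometryEquiv.symm_symm, LinearIsometryEquiv.symm_apply_apply] using
    h.conj_linearIsometryEquiv R.symm hS

/-- **The classical Navier–Stokes predicate is invariant under conjugation by a linear isometry** (both directions).
[cite: MajdaBertozziCUP2002, §1.2 Prop. 1.1 (iii)] -/
theorem isClassicalNSSolutionOn_conj_iff (hS : UniqueDiffOn ℝ S) :
    IsClassicalNSSolutionOn S ν (fun τ x => R (f τ (R.symm x))) (fun τ x => R (u τ (R.symm x)))
        (fun τ x => p τ (R.symm x)) ↔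
      IsClassicalNSSolutionOn S ν f u p :=
  ⟨isClassicalNSSolutionOn_of_conj R hS, fun h => h.conj_linearIsometryEquiv R hS⟩

/-- **Covariance of the unforced classical Euler predicate**: if `(u, p)` is a classical Euler solution with zero force on a
time set of unique differentiability, so is `((τ,x) ↦ R u(τ,R⁻¹x), (τ,x) ↦ p(τ,R⁻¹x))` — the conjugated force `(τ,x) ↦ R 0`
is again `0`. [cite: MajdaBertozziCUP2002, §1.2 Prop. 1.1 (iii)] -/
theorem isClassicalEulerSolutionOn_conj (hS : UniqueDiffOn ℝ S) (h : IsClassicalEulerSolutionOn S 0 u p) :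
    IsClassicalEulerSolutionOn S 0 (fun τ x => R (u τ (R.symm x))) (fun τ x => p τ (R.symm x)) :=
  (IsClassicalNSSolutionOn.conj_linearIsometryEquiv R h hS).congr_force fun t _ x => by simp

/-- Converse of `isClassicalEulerSolutionOn_conj` (conjugate back with `R⁻¹`). [cite: MajdaBertozziCUP2002, §1.2 Prop. 1.1 (iii)] -/
theorem isClassicalEulerSolutionOn_of_conj (hS : UniqueDiffOn ℝ S)
    (h : IsClassicalEulerSolutionOn S 0 (fun τ x => R (u τ (R.symm x))) (fun τ x => p τ (R.symm x))) :
    IsClassicalEulerSolutionOn S 0 u p := by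
  simpa only [LinearIsometryEquiv.symm_symm, LinearIsometryEquiv.symm_apply_apply] using
    isClassicalEulerSolutionOn_conj R.symm hS h

/-- **The unforced classical Euler predicate is invariant under conjugation by a linear isometry** (both directions), on any
time set of unique differentiability. [cite: MajdaBertozziCUP2002, §1.2 Prop. 1.1 (iii)] -/
theorem isClassicalEulerSolutionOn_conj_iff (hS : UniqueDiffOn ℝ S) :
    IsClassicalEulerSolutionOn S 0 (fun τ x => R (u τ (R.symm x))) (fun τ x => p τ (R.symm x)) ↔
      IsClassicalEulerSolutionOn S 0 u p :=
  ⟨isClassicalEulerSolutionOn_of_conj R hS, isClassicalEulerSolutionOn_conj R hS⟩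

/-- The case of the open past `(-∞, T)` (the crux's time set is `Set.Iio 0`): no side condition, `Set.Iio T` has unique
differentiability. [cite: MajdaBertozziCUP2002, §1.2 Prop. 1.1 (iii)] -/
theorem isClassicalEulerSolutionOn_Iio_conj_iff (T : ℝ) :
    IsClassicalEulerSolutionOn (Set.Iio T) 0 (fun τ x => R (u τ (R.symm x))) (fun τ x => p τ (R.symm x)) ↔
      IsClassicalEulerSolutionOn (Set.Iio T) 0 u p :=
  isClassicalEulerSolutionOn_conj_iff R (uniqueDiffOn_Iio T)

/-! ### §2a Envelopes and slab bounds (any inner-product space) -/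

omit [FiniteDimensional ℝ E] in
/-- A pointwise velocity bound is invariant under conjugation: `(∀ x, ‖R v(R⁻¹ x)‖ ≤ B) ↔ (∀ x, ‖v x‖ ≤ B)`. [folklore] -/
theorem forall_norm_conj_le_iff (v : E → E) (B : ℝ) :
    (∀ x, ‖R (v (R.symm x))‖ ≤ B) ↔ ∀ x, ‖v x‖ ≤ B := by
  constructor
  · intro h x
    simpa using h (R x)
  · intro h x
    simpa using h (R.symm x)

omit [FiniteDimensional ℝ E] in
/-- A time-dependent velocity ENVELOPE (`‖u(τ,·)‖_∞ ≤ B(τ)` for the times singled out by `P`) is invariant under conjugation.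
[folklore] -/
theorem forall_forall_norm_conj_le_iff (w : ℝ → E → E) (P : ℝ → Prop) (B : ℝ → ℝ) :
    (∀ τ, P τ → ∀ x, ‖R (w τ (R.symm x))‖ ≤ B τ) ↔ ∀ τ, P τ → ∀ x, ‖w τ x‖ ≤ B τ :=
  forall_congr' fun τ => imp_congr_right fun _ => forall_norm_conj_le_iff R (w τ) (B τ)

omit [FiniteDimensional ℝ E] in
/-- A uniform velocity bound on a time slab `I × E` is invariant under conjugation. [folklore] -/
theorem exists_slabBound_conj_iff (w : ℝ → E → E) (I : Set ℝ) :
    (∃ B : ℝ, ∀ r ∈ I, ∀ x, ‖R (w r (R.symm x))‖ ≤ B) ↔ ∃ B : ℝ, ∀ r ∈ I, ∀ x, ‖w r x‖ ≤ B :=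
  exists_congr fun B => forall_congr' fun r => imp_congr_right fun _ => forall_norm_conj_le_iff R (w r) B

end Classical

/-! ### §2b Tube data and weighted helicity on `ℝ³` (the vorticity is a pseudo-vector, the helicity a pseudo-scalar) -/

section Tube

variable (R : EuclideanSpace ℝ (Fin 3) ≃ₗᵢ[ℝ] EuclideanSpace ℝ (Fin 3))

/-- `det R ≠ 0` for a linear isometry of `ℝ³` (`det R = ±1`). [cite: ArfkenWeber1995, §3.3 Exercise 3.3.2] -/
theorem det_linearIsometryEquiv_ne_zero :
    (R : EuclideanSpace ℝ (Fin 3) →L[ℝ] EuclideanSpace ℝ (Fin 3)).det ≠ 0 := by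
  rcases det_linearIsometryEquiv_eq_one_or_eq_neg_one R with h | h <;> rw [h] <;> norm_num

/-- The first-integral pairing transforms as a pseudo-scalar: for the conjugated slice `R v R⁻¹` and the transported weight
`χ ∘ R⁻¹`, `D(χ∘R⁻¹)(x)[curl (R v R⁻¹)(x)] = det R · Dχ(R⁻¹x)[curl v (R⁻¹x)]` (chain rule and the pseudo-vector law
`curl (R v R⁻¹) = det R • R curl v ∘ R⁻¹`).
[cite: ArfkenWeber1995, §2.9 eq. (2.90), (2.97)–(2.99)] -/
theorem fderiv_comp_symm_apply_curl_conj (v : EuclideanSpace ℝ (Fin 3) → EuclideanSpace ℝ (Fin 3))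
    (χ : EuclideanSpace ℝ (Fin 3) → ℝ) (x : EuclideanSpace ℝ (Fin 3)) :
    fderiv ℝ (fun y => χ (R.symm y)) x (curl (fun y => R (v (R.symm y))) x) =
      (R : EuclideanSpace ℝ (Fin 3) →L[ℝ] EuclideanSpace ℝ (Fin 3)).det *
        fderiv ℝ χ (R.symm x) (curl v (R.symm x)) := by
  rw [fderiv_comp_linearIsometryEquiv_symm, curl_conj_linearIsometryEquiv, ContinuousLinearMap.comp_apply,
    map_smul]
  simp [smul_eq_mul]

/-- **Tube data are frame-free.**  `χ ∘ R⁻¹` is a coherent vortex-tube datum (smooth, `|·| ≤ 1`, vanishing outside `B(0, Rd)`,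
first integral of the vorticity) of the conjugated slice `R v R⁻¹` iff `χ` is one of `v`. [cite: ArfkenWeber1995, §2.9 eq. (2.90), (2.97)–(2.99)] -/
theorem tubeWeight_conj_iff (v : EuclideanSpace ℝ (Fin 3) → EuclideanSpace ℝ (Fin 3))
    (χ : EuclideanSpace ℝ (Fin 3) → ℝ) (Rd : ℝ) :
    (ContDiff ℝ ∞ (fun y => χ (R.symm y)) ∧ (∀ x : EuclideanSpace ℝ (Fin 3), |χ (R.symm x)| ≤ 1) ∧
        (∀ x : EuclideanSpace ℝ (Fin 3), Rd ≤ ‖x‖ → χ (R.symm x) = 0) ∧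
        ∀ x : EuclideanSpace ℝ (Fin 3),
          fderiv ℝ (fun y => χ (R.symm y)) x (curl (fun y => R (v (R.symm y))) x) = 0) ↔
      (ContDiff ℝ ∞ χ ∧ (∀ x : EuclideanSpace ℝ (Fin 3), |χ x| ≤ 1) ∧
        (∀ x : EuclideanSpace ℝ (Fin 3), Rd ≤ ‖x‖ → χ x = 0) ∧
        ∀ x : EuclideanSpace ℝ (Fin 3), fderiv ℝ χ x (curl v x) = 0) := by
  refine and_congr ?_ (and_congr ?_ (and_congr ?_ ?_))
  · simpa only [Function.comp_def, LinearIsometryEquiv.coe_toContinuousLinearEquiv] using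
      R.symm.toContinuousLinearEquiv.contDiff_comp_iff (f := χ) (n := ∞)
  · constructor
    · intro h x
      simpa using h (R x)
    · intro h x
      exact h (R.symm x)
  · constructor
    · intro h x hx
      simpa using h (R x) (by simpa using hx)
    · intro h x hx
      exact h (R.symm x) (by simpa using hx)
  · simp_rw [fderiv_comp_symm_apply_curl_conj, mul_eq_zero, or_iff_right (det_linearIsometryEquiv_ne_zero R)]
    constructor
    · intro h x
      simpa using h (R x)
    · intro h x
      exact h (R.symm x)

/-- **The weighted (Moffatt) helicity is a pseudo-scalar**: for the conjugated slice and the transported weight,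
`∫ χ(R⁻¹x) ⟪R v(R⁻¹x), curl (R v R⁻¹)(x)⟫ dx = det R · ∫ χ ⟪v, curl v⟫` (helicity density pseudo-scalar law
`inner_self_curl_conj_linearIsometryEquiv` and the volume-preserving change of variables `x = R y`).
[cite: ArfkenWeber1995, §2.9 eq. (2.90)] -/
theorem weightedHelicity_conj (v : EuclideanSpace ℝ (Fin 3) → EuclideanSpace ℝ (Fin 3))
    (χ : EuclideanSpace ℝ (Fin 3) → ℝ) :
    ∫ x, χ (R.symm x) * ⟪R (v (R.symm x)), curl (fun y => R (v (R.symm y))) x⟫ =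
      (R : EuclideanSpace ℝ (Fin 3) →L[ℝ] EuclideanSpace ℝ (Fin 3)).det * ∫ x, χ x * ⟪v x, curl v x⟫ := by
  simp_rw [inner_self_curl_conj_linearIsometryEquiv]
  have h := R.symm.measurePreserving.integral_comp R.symm.toHomeomorph.measurableEmbedding
    (fun y => χ y * ((R : EuclideanSpace ℝ (Fin 3) →L[ℝ] EuclideanSpace ℝ (Fin 3)).det * ⟪v y, curl v y⟫))
  rw [h, ← integral_const_mul]
  refine integral_congr_ae (Filter.Eventually.of_forall fun y => ?_)
  ring

/-- Non-vanishing of the weighted helicity is frame-free (`det R = ±1`): BOTH chiralities belong to one stratum.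
[cite: ArfkenWeber1995, §2.9 eq. (2.90)] -/
theorem weightedHelicity_conj_ne_zero_iff (v : EuclideanSpace ℝ (Fin 3) → EuclideanSpace ℝ (Fin 3))
    (χ : EuclideanSpace ℝ (Fin 3) → ℝ) :
    (∫ x, χ (R.symm x) * ⟪R (v (R.symm x)), curl (fun y => R (v (R.symm y))) x⟫) ≠ 0 ↔
      (∫ x, χ x * ⟪v x, curl v x⟫) ≠ 0 := by
  rw [weightedHelicity_conj, mul_ne_zero_iff, and_iff_right (det_linearIsometryEquiv_ne_zero R)]

end Tube

/-! ### §3 The classical tube strata of skeleton v115 are frame-invariant (δ-unfolded texts of `Lines/birth.lean`) -/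

section Strata

variable (R : EuclideanSpace ℝ (Fin 3) ≃ₗᵢ[ℝ] EuclideanSpace ℝ (Fin 3))
  {u : ℝ → EuclideanSpace ℝ (Fin 3) → EuclideanSpace ℝ (Fin 3)} {p : ℝ → EuclideanSpace ℝ (Fin 3) → ℝ}

/-- **`IsChiralTubePast` is covariant** (text of skeleton v115 / line `chiral_anchor`, δ-unfolded): if `(u, p)` is a classical
Euler flow on the open past with an anchor time `t₀ < 0` (velocity bounded on every slab `[t₁, t₀] × ℝ³`) and a coherent vortex-tube
datum of the slice `u t₀` of NON-ZERO weighted helicity, then so is the conjugated pair `((τ,x) ↦ R u(τ,R⁻¹x), (τ,x) ↦ p(τ,R⁻¹x))`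
— with the same `t₀`, the same bounds, the transported datum `χ ∘ R⁻¹` and helicity `det R · 𝓗_χ ≠ 0`.
[cite: MajdaBertozziCUP2002, §1.2 Prop. 1.1 (iii); ArfkenWeber1995, §2.9 eq. (2.90)] -/
theorem chiralTubePast_conj
    (h : IsClassicalEulerSolutionOn (Set.Iio 0) 0 u p ∧
      ∃ t₀ : ℝ, t₀ < 0 ∧
        (∀ t₁ : ℝ, t₁ < t₀ → ∃ B : ℝ, ∀ r ∈ Set.Icc t₁ t₀, ∀ x, ‖u r x‖ ≤ B) ∧
        ∃ (χ : EuclideanSpace ℝ (Fin 3) → ℝ) (Rd : ℝ), 0 < Rd ∧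
          (ContDiff ℝ ∞ χ ∧ (∀ x : EuclideanSpace ℝ (Fin 3), |χ x| ≤ 1) ∧
              (∀ x : EuclideanSpace ℝ (Fin 3), Rd ≤ ‖x‖ → χ x = 0) ∧
              ∀ x : EuclideanSpace ℝ (Fin 3), fderiv ℝ χ x (curl (u t₀) x) = 0) ∧
            (∫ x, χ x * inner ℝ (u t₀ x) (curl (u t₀) x)) ≠ 0) :
    IsClassicalEulerSolutionOn (Set.Iio 0) 0 (fun τ x => R (u τ (R.symm x))) (fun τ x => p τ (R.symm x)) ∧
      ∃ t₀ : ℝ, t₀ < 0 ∧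
        (∀ t₁ : ℝ, t₁ < t₀ → ∃ B : ℝ, ∀ r ∈ Set.Icc t₁ t₀, ∀ x,
          ‖(fun τ x => R (u τ (R.symm x))) r x‖ ≤ B) ∧
        ∃ (χ : EuclideanSpace ℝ (Fin 3) → ℝ) (Rd : ℝ), 0 < Rd ∧
          (ContDiff ℝ ∞ χ ∧ (∀ x : EuclideanSpace ℝ (Fin 3), |χ x| ≤ 1) ∧
              (∀ x : EuclideanSpace ℝ (Fin 3), Rd ≤ ‖x‖ → χ x = 0) ∧
              ∀ x, fderiv ℝ χ x (curl ((fun τ x => R (u τ (R.symm x))) t₀) x) = 0) ∧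
            (∫ x, χ x * inner ℝ ((fun τ x => R (u τ (R.symm x))) t₀ x)
              (curl ((fun τ x => R (u τ (R.symm x))) t₀) x)) ≠ 0 := by
  obtain ⟨hcl, t₀, ht₀, hB, χ, Rd, hRd, hχ, hH⟩ := h
  refine ⟨isClassicalEulerSolutionOn_conj R (uniqueDiffOn_Iio 0) hcl, t₀, ht₀, fun t₁ ht₁ => ?_,
    fun y => χ (R.symm y), Rd, hRd, ?_, ?_⟩
  · exact (exists_slabBound_conj_iff R u (Set.Icc t₁ t₀)).2 (hB t₁ ht₁)
  · exact (tubeWeight_conj_iff R (u t₀) χ Rd).2 hχ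
  · exact (weightedHelicity_conj_ne_zero_iff R (u t₀) χ).2 hH

/-- **Converse**: a chiral tube past of the conjugated pair gives one of `(u, p)` (conjugate back with `R⁻¹`).
This is the ONE NAME that fills a binder `¬ ∃ R, IsChiralTubePast (R u R⁻¹) (p ∘ R⁻¹)` from a member theorem for `IsChiralTubePast u p`.
[cite: MajdaBertozziCUP2002, §1.2 Prop. 1.1 (iii); ArfkenWeber1995, §2.9 eq. (2.90)] -/
theorem chiralTubePast_of_conj
    (h : IsClassicalEulerSolutionOn (Set.Iio 0) 0 (fun τ x => R (u τ (R.symm x))) (fun τ x => p τ (R.symm x)) ∧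
      ∃ t₀ : ℝ, t₀ < 0 ∧
        (∀ t₁ : ℝ, t₁ < t₀ → ∃ B : ℝ, ∀ r ∈ Set.Icc t₁ t₀, ∀ x,
          ‖(fun τ x => R (u τ (R.symm x))) r x‖ ≤ B) ∧
        ∃ (χ : EuclideanSpace ℝ (Fin 3) → ℝ) (Rd : ℝ), 0 < Rd ∧
          (ContDiff ℝ ∞ χ ∧ (∀ x : EuclideanSpace ℝ (Fin 3), |χ x| ≤ 1) ∧
              (∀ x : EuclideanSpace ℝ (Fin 3), Rd ≤ ‖x‖ → χ x = 0) ∧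
              ∀ x, fderiv ℝ χ x (curl ((fun τ x => R (u τ (R.symm x))) t₀) x) = 0) ∧
            (∫ x, χ x * inner ℝ ((fun τ x => R (u τ (R.symm x))) t₀ x)
              (curl ((fun τ x => R (u τ (R.symm x))) t₀) x)) ≠ 0) :
    IsClassicalEulerSolutionOn (Set.Iio 0) 0 u p ∧
      ∃ t₀ : ℝ, t₀ < 0 ∧
        (∀ t₁ : ℝ, t₁ < t₀ → ∃ B : ℝ, ∀ r ∈ Set.Icc t₁ t₀, ∀ x, ‖u r x‖ ≤ B) ∧
        ∃ (χ : EuclideanSpace ℝ (Fin 3) → ℝ) (Rd : ℝ), 0 < Rd ∧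
          (ContDiff ℝ ∞ χ ∧ (∀ x : EuclideanSpace ℝ (Fin 3), |χ x| ≤ 1) ∧
              (∀ x : EuclideanSpace ℝ (Fin 3), Rd ≤ ‖x‖ → χ x = 0) ∧
              ∀ x : EuclideanSpace ℝ (Fin 3), fderiv ℝ χ x (curl (u t₀) x) = 0) ∧
            (∫ x, χ x * inner ℝ (u t₀ x) (curl (u t₀) x)) ≠ 0 := by
  simpa only [LinearIsometryEquiv.symm_symm, LinearIsometryEquiv.symm_apply_apply] using
    chiralTubePast_conj R.symm (u := fun τ x => R (u τ (R.symm x))) (p := fun τ x => p τ (R.symm x)) h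

/-- **The `∃ R`-widened chiral-tube binder collapses to the registered one**: «some placement `R u R⁻¹` has a chiral tube past» iff
`u` itself has one — so the v114 binder `¬ IsChiralTubePast u p` already denies every frame.
[cite: MajdaBertozziCUP2002, §1.2 Prop. 1.1 (iii); ArfkenWeber1995, §2.9 eq. (2.90)] -/
theorem exists_chiralTubePast_conj_iff :
    (∃ R : EuclideanSpace ℝ (Fin 3) ≃ₗᵢ[ℝ] EuclideanSpace ℝ (Fin 3),
      IsClassicalEulerSolutionOn (Set.Iio 0) 0 (fun τ x => R (u τ (R.symm x))) (fun τ x => p τ (R.symm x)) ∧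
        ∃ t₀ : ℝ, t₀ < 0 ∧
          (∀ t₁ : ℝ, t₁ < t₀ → ∃ B : ℝ, ∀ r ∈ Set.Icc t₁ t₀, ∀ x,
            ‖(fun τ x => R (u τ (R.symm x))) r x‖ ≤ B) ∧
          ∃ (χ : EuclideanSpace ℝ (Fin 3) → ℝ) (Rd : ℝ), 0 < Rd ∧
            (ContDiff ℝ ∞ χ ∧ (∀ x : EuclideanSpace ℝ (Fin 3), |χ x| ≤ 1) ∧
                (∀ x : EuclideanSpace ℝ (Fin 3), Rd ≤ ‖x‖ → χ x = 0) ∧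
                ∀ x, fderiv ℝ χ x (curl ((fun τ x => R (u τ (R.symm x))) t₀) x) = 0) ∧
              (∫ x, χ x * inner ℝ ((fun τ x => R (u τ (R.symm x))) t₀ x)
                (curl ((fun τ x => R (u τ (R.symm x))) t₀) x)) ≠ 0) ↔
    (IsClassicalEulerSolutionOn (Set.Iio 0) 0 u p ∧
      ∃ t₀ : ℝ, t₀ < 0 ∧
        (∀ t₁ : ℝ, t₁ < t₀ → ∃ B : ℝ, ∀ r ∈ Set.Icc t₁ t₀, ∀ x, ‖u r x‖ ≤ B) ∧
        ∃ (χ : EuclideanSpace ℝ (Fin 3) → ℝ) (Rd : ℝ), 0 < Rd ∧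
          (ContDiff ℝ ∞ χ ∧ (∀ x : EuclideanSpace ℝ (Fin 3), |χ x| ≤ 1) ∧
              (∀ x : EuclideanSpace ℝ (Fin 3), Rd ≤ ‖x‖ → χ x = 0) ∧
              ∀ x : EuclideanSpace ℝ (Fin 3), fderiv ℝ χ x (curl (u t₀) x) = 0) ∧
            (∫ x, χ x * inner ℝ (u t₀ x) (curl (u t₀) x)) ≠ 0) :=
  ⟨fun ⟨R, h⟩ => chiralTubePast_of_conj R h, fun h => ⟨LinearIsometryEquiv.refl ℝ _, chiralTubePast_conj _ h⟩⟩

/-- **`IsHelicalTubePast ρ` is covariant** (text of skeleton v115 / line `helicity_tube` rev4, δ-unfolded): a drifting classical far past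
`(T₁, M, κ)` (velocity envelope `M(−τ)^{−κ}`) above the helicity drift threshold `(1−3ρ)/(2−3ρ)` carrying at some `τ < T₁` a coherent
vortex-tube datum of non-zero weighted helicity is transported to the conjugated pair with the SAME `(T₁, M, κ, τ)`, the datum `χ ∘ R⁻¹`
and helicity `det R · 𝓗_χ`. [cite: MajdaBertozziCUP2002, §1.2 Prop. 1.1 (iii); ArfkenWeber1995, §2.9 eq. (2.90)] -/
theorem helicalTubePast_conj {ρ : ℝ}
    (h : ∃ T₁ M κ : ℝ,
      (IsClassicalEulerSolutionOn (Set.Iio 0) 0 u p ∧ T₁ ≤ 0 ∧ 0 ≤ M ∧ κ < 1 ∧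
          (∀ τ : ℝ, τ < T₁ → ∀ x, ‖u τ x‖ ≤ M * (-τ) ^ (-κ))) ∧
        (1 - 3 * ρ) / (2 - 3 * ρ) < κ ∧
        ∃ τ : ℝ, τ < T₁ ∧ ∃ (χ : EuclideanSpace ℝ (Fin 3) → ℝ) (Rd : ℝ), 0 < Rd ∧
          (ContDiff ℝ ∞ χ ∧ (∀ x : EuclideanSpace ℝ (Fin 3), |χ x| ≤ 1) ∧
              (∀ x : EuclideanSpace ℝ (Fin 3), Rd ≤ ‖x‖ → χ x = 0) ∧
              ∀ x : EuclideanSpace ℝ (Fin 3), fderiv ℝ χ x (curl (u τ) x) = 0) ∧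
            (∫ x, χ x * inner ℝ (u τ x) (curl (u τ) x)) ≠ 0) :
    ∃ T₁ M κ : ℝ,
      (IsClassicalEulerSolutionOn (Set.Iio 0) 0 (fun τ x => R (u τ (R.symm x))) (fun τ x => p τ (R.symm x)) ∧
            T₁ ≤ 0 ∧ 0 ≤ M ∧ κ < 1 ∧
          (∀ τ : ℝ, τ < T₁ → ∀ x,
            ‖(fun τ x => R (u τ (R.symm x))) τ x‖ ≤ M * (-τ) ^ (-κ))) ∧
        (1 - 3 * ρ) / (2 - 3 * ρ) < κ ∧
        ∃ τ : ℝ, τ < T₁ ∧ ∃ (χ : EuclideanSpace ℝ (Fin 3) → ℝ) (Rd : ℝ), 0 < Rd ∧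
          (ContDiff ℝ ∞ χ ∧ (∀ x : EuclideanSpace ℝ (Fin 3), |χ x| ≤ 1) ∧
              (∀ x : EuclideanSpace ℝ (Fin 3), Rd ≤ ‖x‖ → χ x = 0) ∧
              ∀ x, fderiv ℝ χ x (curl ((fun τ x => R (u τ (R.symm x))) τ) x) = 0) ∧
            (∫ x, χ x * inner ℝ ((fun τ x => R (u τ (R.symm x))) τ x)
              (curl ((fun τ x => R (u τ (R.symm x))) τ) x)) ≠ 0 := by
  obtain ⟨T₁, M, κ, ⟨hcl, hT₁, hM, hκ, henv⟩, hthr, τ, hτ, χ, Rd, hRd, hχ, hH⟩ := h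
  refine ⟨T₁, M, κ, ⟨isClassicalEulerSolutionOn_conj R (uniqueDiffOn_Iio 0) hcl, hT₁, hM, hκ, ?_⟩, hthr, τ, hτ,
    fun y => χ (R.symm y), Rd, hRd, ?_, ?_⟩
  · exact (forall_forall_norm_conj_le_iff R u (fun σ => σ < T₁) (fun σ => M * (-σ) ^ (-κ))).2 henv
  · exact (tubeWeight_conj_iff R (u τ) χ Rd).2 hχ
  · exact (weightedHelicity_conj_ne_zero_iff R (u τ) χ).2 hH

/-- **Converse**: a helical tube past of the conjugated pair gives one of `(u, p)` — the ONE NAME that fills a binder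
`¬ ∃ R, IsHelicalTubePast ρ (R u R⁻¹) (p ∘ R⁻¹)` from a member theorem for `IsHelicalTubePast ρ u p`.
[cite: MajdaBertozziCUP2002, §1.2 Prop. 1.1 (iii); ArfkenWeber1995, §2.9 eq. (2.90)] -/
theorem helicalTubePast_of_conj {ρ : ℝ}
    (h : ∃ T₁ M κ : ℝ,
      (IsClassicalEulerSolutionOn (Set.Iio 0) 0 (fun τ x => R (u τ (R.symm x))) (fun τ x => p τ (R.symm x)) ∧
            T₁ ≤ 0 ∧ 0 ≤ M ∧ κ < 1 ∧
          (∀ τ : ℝ, τ < T₁ → ∀ x,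
            ‖(fun τ x => R (u τ (R.symm x))) τ x‖ ≤ M * (-τ) ^ (-κ))) ∧
        (1 - 3 * ρ) / (2 - 3 * ρ) < κ ∧
        ∃ τ : ℝ, τ < T₁ ∧ ∃ (χ : EuclideanSpace ℝ (Fin 3) → ℝ) (Rd : ℝ), 0 < Rd ∧
          (ContDiff ℝ ∞ χ ∧ (∀ x : EuclideanSpace ℝ (Fin 3), |χ x| ≤ 1) ∧
              (∀ x : EuclideanSpace ℝ (Fin 3), Rd ≤ ‖x‖ → χ x = 0) ∧
              ∀ x, fderiv ℝ χ x (curl ((fun τ x => R (u τ (R.symm x))) τ) x) = 0) ∧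
            (∫ x, χ x * inner ℝ ((fun τ x => R (u τ (R.symm x))) τ x)
              (curl ((fun τ x => R (u τ (R.symm x))) τ) x)) ≠ 0) :
    ∃ T₁ M κ : ℝ,
      (IsClassicalEulerSolutionOn (Set.Iio 0) 0 u p ∧ T₁ ≤ 0 ∧ 0 ≤ M ∧ κ < 1 ∧
          (∀ τ : ℝ, τ < T₁ → ∀ x, ‖u τ x‖ ≤ M * (-τ) ^ (-κ))) ∧
        (1 - 3 * ρ) / (2 - 3 * ρ) < κ ∧
        ∃ τ : ℝ, τ < T₁ ∧ ∃ (χ : EuclideanSpace ℝ (Fin 3) → ℝ) (Rd : ℝ), 0 < Rd ∧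
          (ContDiff ℝ ∞ χ ∧ (∀ x : EuclideanSpace ℝ (Fin 3), |χ x| ≤ 1) ∧
              (∀ x : EuclideanSpace ℝ (Fin 3), Rd ≤ ‖x‖ → χ x = 0) ∧
              ∀ x : EuclideanSpace ℝ (Fin 3), fderiv ℝ χ x (curl (u τ) x) = 0) ∧
            (∫ x, χ x * inner ℝ (u τ x) (curl (u τ) x)) ≠ 0 := by
  simpa only [LinearIsometryEquiv.symm_symm, LinearIsometryEquiv.symm_apply_apply] using
    helicalTubePast_conj R.symm (u := fun τ x => R (u τ (R.symm x))) (p := fun τ x => p τ (R.symm x)) h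

/-- **The `∃ R`-widened helical-tube binder collapses to the registered one**: «some placement `R u R⁻¹` has a helical tube past
of exponent `ρ`» iff `u` itself has one. [cite: MajdaBertozziCUP2002, §1.2 Prop. 1.1 (iii); ArfkenWeber1995, §2.9 eq. (2.90)] -/
theorem exists_helicalTubePast_conj_iff {ρ : ℝ} :
    (∃ R : EuclideanSpace ℝ (Fin 3) ≃ₗᵢ[ℝ] EuclideanSpace ℝ (Fin 3), ∃ T₁ M κ : ℝ,
      (IsClassicalEulerSolutionOn (Set.Iio 0) 0 (fun τ x => R (u τ (R.symm x))) (fun τ x => p τ (R.symm x)) ∧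
            T₁ ≤ 0 ∧ 0 ≤ M ∧ κ < 1 ∧
          (∀ τ : ℝ, τ < T₁ → ∀ x,
            ‖(fun τ x => R (u τ (R.symm x))) τ x‖ ≤ M * (-τ) ^ (-κ))) ∧
        (1 - 3 * ρ) / (2 - 3 * ρ) < κ ∧
        ∃ τ : ℝ, τ < T₁ ∧ ∃ (χ : EuclideanSpace ℝ (Fin 3) → ℝ) (Rd : ℝ), 0 < Rd ∧
          (ContDiff ℝ ∞ χ ∧ (∀ x : EuclideanSpace ℝ (Fin 3), |χ x| ≤ 1) ∧
              (∀ x : EuclideanSpace ℝ (Fin 3), Rd ≤ ‖x‖ → χ x = 0) ∧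
              ∀ x, fderiv ℝ χ x (curl ((fun τ x => R (u τ (R.symm x))) τ) x) = 0) ∧
            (∫ x, χ x * inner ℝ ((fun τ x => R (u τ (R.symm x))) τ x)
              (curl ((fun τ x => R (u τ (R.symm x))) τ) x)) ≠ 0) ↔
    ∃ T₁ M κ : ℝ,
      (IsClassicalEulerSolutionOn (Set.Iio 0) 0 u p ∧ T₁ ≤ 0 ∧ 0 ≤ M ∧ κ < 1 ∧
          (∀ τ : ℝ, τ < T₁ → ∀ x, ‖u τ x‖ ≤ M * (-τ) ^ (-κ))) ∧
        (1 - 3 * ρ) / (2 - 3 * ρ) < κ ∧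
        ∃ τ : ℝ, τ < T₁ ∧ ∃ (χ : EuclideanSpace ℝ (Fin 3) → ℝ) (Rd : ℝ), 0 < Rd ∧
          (ContDiff ℝ ∞ χ ∧ (∀ x : EuclideanSpace ℝ (Fin 3), |χ x| ≤ 1) ∧
              (∀ x : EuclideanSpace ℝ (Fin 3), Rd ≤ ‖x‖ → χ x = 0) ∧
              ∀ x : EuclideanSpace ℝ (Fin 3), fderiv ℝ χ x (curl (u τ) x) = 0) ∧
            (∫ x, χ x * inner ℝ (u τ x) (curl (u τ) x)) ≠ 0 :=
  ⟨fun ⟨R, h⟩ => helicalTubePast_of_conj R h, fun h => ⟨LinearIsometryEquiv.refl ℝ _, helicalTubePast_conj _ h⟩⟩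

end Strata

end Summit.NavierStokesRegularity.NavierStokesRegularity.Theorems.PowerGaugeEulerLiouville.ClassIsometry

end
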